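import Summits.NavierStokesRegularity.NavierStokesRegularity.Theorems.TypeICertificateLadderTargetDepletionAlignmentDefect
import Summits.NavierStokesRegularity.NavierStokesRegularity.Theorems.DssFarFieldSlavingBlowupTypeIDssProfileSimilarityEnstrophyLambCore
import HarnessLib

/-!
# Crux `Target` = `TypeICertificateLadder.NoTypeIBlowup` (stmt-NavierStokesRegularity-1217), line
# `depletion-ladder`, stub S1 `stub_depletionBelowHalf`: the alignment IDENTITY, `R² + D ≤ 1`, `Q ≤ A ≤ 1 − R²`

`--supports stmt-NavierStokesRegularity-1217` (line `depletion-ladder`; third file of the seat's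
"structure of near-extremisers" series after `…TargetDepletionLambPairing.lean` and
`…TargetDepletionAlignmentDefect.lean`).

* `integral_norm_curl_curl_sq_eq` — for `u ∈ C³` with `ω = curl u ∈ L²`, `|∇ω|_F ∈ L²`:
  `‖curl ω‖₂ = ‖∇ω‖₂` (the divergence-free `ω` has no compression part; tree
  `integral_norm_curl_sq_eq_integral_frobeniusNormSq`), so the defect laws of the companion file
  read in S1's own normalisation: `sq_integral_stretching_add_defect_le` (`R² + D ≤ 1`,
  `R = ∫⟪ω,Duω⟫/(M‖ω‖₂‖∇ω‖₂)`, `D = ‖⟪u, curl ω⟫‖₂²/(M²‖∇ω‖₂²)`) and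
  `sq_integral_stretching_add_direction_defect_le` (`R² + A ≤ 1`,
  `A = ∫(⟪u,curl ω⟫²/‖u‖²)/‖∇ω‖₂² ≥ D`). A sequence of fields saturating `κ = 1` must have `A → 0`.
* `integral_inner_curl_curl_eq` — **the alignment identity** (finite energy, `u ∈ C² ∩ L²`):
  `∫⟪u, curl ω⟫ = ‖ω‖₂²`: the velocity is FORCED to correlate with the palinstrophy field — the
  obstruction to `A → 0` (cut-off form of `∫⟪u, curl ω⟫ = ∫⟪curl u, ω⟫`, tree
  `integral_mul_inner_curl_eq`).
* `sq_integral_inner_curl_curl_le` — Cauchy–Schwarz: `(∫⟪u, curl ω⟫)² ≤ ‖u‖₂² ∫⟪u,curl ω⟫²/‖u‖²`,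
  i.e. `A ≥ Q := ‖ω‖₂⁴/(‖u‖₂²‖curl ω‖₂²)`; whence `sq_integral_stretching_add_concentration_le`:
  `R² + Q ≤ 1` — the landed spectral-concentration constraint
  (`sq_integral_inner_convect_laplacian_le_mul_one_sub`, stated there for `C³` fields with
  `D²u, D³u ∈ L²` in convective variables) re-derived on the lighter class (`C²`, finite energy) as the
  weakest member of the chain `Q ≤ A ≤ 1 − R²`.

WHAT THIS IS NOT: not a bound `κ̂ < 1`; on the class neither `A` nor `D` is bounded below (dilute
fields make `Q → 0`), and the numerical maximisers (`R ≈ 0.14`, `A ≈ 0.8`, kit jobs of this seat on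
1217) are far from saturation. Elementary. [folklore]

References: Lu–Doering, Indiana Univ. Math. J. 57 (2008) 2693–2727; Doering–Gibbon 1995, (1.4.20)
(`‖∇u‖₂ = ‖curl u‖₂`); Majda–Bertozzi 2002, §1.1 (vector identities).
-/

noncomputable section

open Set Function Filter Topology MeasureTheory
open scoped RealInnerProductSpace ENNReal NNReal ContDiff
open Literature.Analysis.FluidPDE

namespace Summit.NavierStokesRegularity.NavierStokesRegularity.Theorems.DepletionLadder

-- the problem directory repeats the summit name (`NavierStokesRegularity/NavierStokesRegularity`)
set_option linter.dupNamespace false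

open Summit.NavierStokesRegularity.NavierStokesRegularity.Theorems.SimilarityEnstrophy

section Class

variable {u : EuclideanSpace ℝ (Fin 3) → EuclideanSpace ℝ (Fin 3)} {M : ℝ}

/-! ## S1's own normalisation (`u ∈ C³`: `‖curl ω‖₂ = ‖∇ω‖₂`) -/

/-- For `u ∈ C³` with `ω = curl u ∈ L²` and `|∇ω|_F ∈ L²`: `∫‖curl ω‖² = ∫|∇ω|²_F` — the
divergence-free field `ω` has no compression part (tree
`integral_norm_curl_sq_eq_integral_frobeniusNormSq`, whose integrability input `(ω·∇)ω ∈ L¹` holds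
here by `‖Dω ω‖ ≤ |Dω|_F‖ω‖`). [folklore] -/
theorem integral_norm_curl_curl_sq_eq (hu : ContDiff ℝ 3 u)
    (iZ : Integrable (fun x => ‖curl u x‖ ^ 2))
    (iA : Integrable (fun x => frobeniusNormSq (fderiv ℝ (curl u) x))) :
    ∫ x, ‖curl (curl u) x‖ ^ 2 = ∫ x, frobeniusNormSq (fderiv ℝ (curl u) x) := by
  have hu2 : ContDiff ℝ 2 u := hu.of_le (by norm_num)
  have hu1 : ContDiff ℝ 1 u := hu.of_le (by norm_num)
  have hω2 : ContDiff ℝ 2 (curl u) := by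
    rw [curl_eq_curlCLM_comp]
    exact curlCLM.contDiff.comp (hu.fderiv_right (m := 2) (by norm_num))
  have hdivω : VectorCalculus.IsDivFree (curl u) := fun x => divergence_curl_eq_zero_holds u hu2 x
  have cω : Continuous (curl u) := continuous_curl hu1
  have cDω : Continuous (fderiv ℝ (curl u)) :=
    (contDiff_one_curl_of_contDiff_two hu2).continuous_fderiv one_ne_zero
  have mω : MemLp (fun x => ‖curl u x‖) 2 volume := memLp_two_norm_curl hu2 iZ
  have mD : MemLp (fun x => ‖fderiv ℝ (curl u) x‖) 2 volume := by
    refine (memLp_two_iff_integrable_sq cDω.norm.aestronglyMeasurable).2 ?_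
    exact iA.mono' (cDω.norm.pow 2).aestronglyMeasurable (Eventually.of_forall fun x => by
      rw [Real.norm_of_nonneg (sq_nonneg _)]; exact sq_opNorm_le_frobeniusNormSq _)
  have iT : Integrable (convect (curl u) (curl u)) := by
    refine (mD.integrable_mul mω).mono' (cDω.clm_apply cω).aestronglyMeasurable
      (Eventually.of_forall fun x => ?_)
    exact (fderiv ℝ (curl u) x).le_opNorm _
  exact integral_norm_curl_sq_eq_integral_frobeniusNormSq hω2 hdivω iA
    (integrable_norm_curl_curl_sq hu2 iA) iT

/-- **The defect law in S1's normalisation, `R² + D ≤ 1`.** For `u ∈ C³(ℝ³; ℝ³)` divergence-free,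
bounded by `M`, with `ω = curl u ∈ L²`, `|∇ω|_F ∈ L²` and integrable stretching density:
`(∫⟪ω, Du ω⟫)² + ‖ω‖₂² · ‖⟪u, curl ω⟫‖₂² ≤ M² ‖ω‖₂² ‖∇ω‖₂²`, i.e. with
`R := ∫⟪ω, Du ω⟫/(M‖ω‖₂‖∇ω‖₂)` (the depletion ratio of S1) and the alignment defect
`D := ‖⟪u, curl ω⟫‖₂²/(M²‖∇ω‖₂²)`: `R² + D ≤ 1`. A sequence of fields saturating the Cauchy–Schwarz
constant `κ = 1` must have `D → 0`. [folklore] -/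
theorem sq_integral_stretching_add_defect_le (hu : ContDiff ℝ 3 u)
    (hdiv : VectorCalculus.IsDivFree u) (hM : ∀ x, ‖u x‖ ≤ M)
    (iZ : Integrable (fun x => ‖curl u x‖ ^ 2))
    (iA : Integrable (fun x => frobeniusNormSq (fderiv ℝ (curl u) x)))
    (iJ : Integrable (fun x => ⟪curl u x, fderiv ℝ u x (curl u x)⟫)) :
    (∫ x, ⟪curl u x, fderiv ℝ u x (curl u x)⟫) ^ 2 +
        (∫ x, ‖curl u x‖ ^ 2) * ∫ x, ⟪u x, curl (curl u) x⟫ ^ 2 ≤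
      M ^ 2 * (∫ x, ‖curl u x‖ ^ 2) * ∫ x, frobeniusNormSq (fderiv ℝ (curl u) x) := by
  have h := sq_integral_stretching_le_defect (hu.of_le (by norm_num)) hdiv hM iZ iA iJ
  rw [integral_norm_curl_curl_sq_eq hu iZ iA] at h
  linarith

/-- **The direction-defect law in S1's normalisation, `R² + A ≤ 1`.** Same class (`u ∈ C³`):
`(∫⟪ω, Du ω⟫)² + M²‖ω‖₂² ∫ ⟪u, curl ω⟫²/‖u‖² ≤ M² ‖ω‖₂² ‖∇ω‖₂²`, i.e. with the aligned
palinstrophy fraction `A := ∫(⟪u, curl ω⟫²/‖u‖²)/‖∇ω‖₂²` (`≥ D`): `R² + A ≤ 1`. [folklore] -/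
theorem sq_integral_stretching_add_direction_defect_le (hu : ContDiff ℝ 3 u)
    (hdiv : VectorCalculus.IsDivFree u) (hM : ∀ x, ‖u x‖ ≤ M)
    (iZ : Integrable (fun x => ‖curl u x‖ ^ 2))
    (iA : Integrable (fun x => frobeniusNormSq (fderiv ℝ (curl u) x)))
    (iJ : Integrable (fun x => ⟪curl u x, fderiv ℝ u x (curl u x)⟫)) :
    (∫ x, ⟪curl u x, fderiv ℝ u x (curl u x)⟫) ^ 2 +
        M ^ 2 * (∫ x, ‖curl u x‖ ^ 2) * ∫ x, ⟪u x, curl (curl u) x⟫ ^ 2 / ‖u x‖ ^ 2 ≤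
      M ^ 2 * (∫ x, ‖curl u x‖ ^ 2) * ∫ x, frobeniusNormSq (fderiv ℝ (curl u) x) := by
  have h := sq_integral_stretching_le_direction_defect (hu.of_le (by norm_num)) hdiv hM iZ iA iJ
  rw [integral_norm_curl_curl_sq_eq hu iZ iA] at h
  linarith

/-! ## Finite energy: the alignment identity and `A ≥ Q` -/

/-- **The alignment identity.** For `u ∈ C²(ℝ³; ℝ³)` with `u ∈ L²`, `ω = curl u ∈ L²` and
`|∇ω|_F ∈ L²`: `∫ ⟪u, curl ω⟫ = ∫ ‖ω‖²` — the velocity must carry an `L²`-correlation with the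
palinstrophy field `curl ω` equal to the enstrophy (cut-off form of `∫⟪u, curl ω⟫ = ∫⟪curl u, ω⟫`,
tree `integral_mul_inner_curl_eq`; the cut-off error is `≤ ‖curlCLM‖·C·‖u‖₂‖ω‖₂/R`). This is the
obstruction to Cauchy–Schwarz saturation (`u ⊥ curl ω`) behind every defect law of this file.
[folklore] -/
theorem integral_inner_curl_curl_eq (hu : ContDiff ℝ 2 u)
    (iE : Integrable (fun x => ‖u x‖ ^ 2))
    (iZ : Integrable (fun x => ‖curl u x‖ ^ 2))
    (iA : Integrable (fun x => frobeniusNormSq (fderiv ℝ (curl u) x))) :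
    ∫ x, ⟪u x, curl (curl u) x⟫ = ∫ x, ‖curl u x‖ ^ 2 := by
  obtain ⟨C, hC0, hC⟩ := exists_norm_fderiv_cutoff_le (E := EuclideanSpace ℝ (Fin 3))
  have hu1 : ContDiff ℝ 1 u := hu.of_le (by norm_num)
  have hω1 : ContDiff ℝ 1 (curl u) := contDiff_one_curl_of_contDiff_two hu
  have cω : Continuous (curl u) := hω1.continuous
  have cc : Continuous (curl (curl u)) := continuous_curl hω1
  have mu : MemLp (fun x => ‖u x‖) 2 volume :=
    (memLp_two_iff_integrable_sq hu.continuous.norm.aestronglyMeasurable).2 iE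
  have mω : MemLp (fun x => ‖curl u x‖) 2 volume := memLp_two_norm_curl hu iZ
  have mc : MemLp (fun x => ‖curl (curl u) x‖) 2 volume := memLp_two_norm_curl_curl hu iA
  have iuc : Integrable (fun x => ⟪u x, curl (curl u) x⟫) :=
    (mu.integrable_mul mc).mono' (hu.continuous.inner cc).aestronglyMeasurable
      (Eventually.of_forall fun x => (norm_inner_le_norm _ _))
  have iuω : Integrable (fun x => ‖u x‖ * ‖curl u x‖) := mu.integrable_mul mω
  set Z : ℝ := ∫ x, ‖curl u x‖ ^ 2 with hZdef
  set P : ℝ := ∫ x, ⟪u x, curl (curl u) x⟫ with hPdef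
  -- the three sequences of the cut-off identity
  set a : ℕ → ℝ := fun n => ∫ x, cutoff ((n : ℝ) + 1) x * ⟪curl u x, curl u x⟫
  set b : ℕ → ℝ := fun n => ∫ x, cutoff ((n : ℝ) + 1) x * ⟪u x, curl (curl u) x⟫
  set d : ℕ → ℝ := fun n =>
    ∫ x, ⟪u x, curlCLM ((fderiv ℝ (cutoff ((n : ℝ) + 1)) x).smulRight (curl u x))⟫
  have hid : ∀ n : ℕ, a n = b n + d n := fun n =>
    integral_mul_inner_curl_eq hu1 hω1 (contDiff_cutoff _) (hasCompactSupport_cutoff (by positivity))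
  -- `a n → Z`
  have ha : Tendsto a atTop (𝓝 Z) := by
    have hZ' : Z = ∫ x, ⟪curl u x, curl u x⟫ :=
      integral_congr_ae (Eventually.of_forall fun x => (real_inner_self_eq_norm_sq _).symm)
    rw [hZ']
    have iωω : Integrable (fun x => ⟪curl u x, curl u x⟫) :=
      iZ.congr (Eventually.of_forall fun x => (real_inner_self_eq_norm_sq _).symm)
    refine tendsto_integral_of_dominated_convergence (fun x => ‖⟪curl u x, curl u x⟫‖)
      (fun n => (((contDiff_cutoff (n := 1) ((n : ℝ) + 1)).continuous).mul (cω.inner cω)).aestronglyMeasurable)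
      iωω.norm (fun n => Eventually.of_forall fun x => ?_) (Eventually.of_forall fun x => ?_)
    · rw [norm_mul, Real.norm_eq_abs]
      exact mul_le_of_le_one_left (norm_nonneg _) (abs_cutoff_le_one _ x)
    · have h := (tendsto_cutoff_natCast_add_one x).mul_const ⟪curl u x, curl u x⟫
      rwa [one_mul] at h
  -- `b n → P`
  have hb : Tendsto b atTop (𝓝 P) := by
    refine tendsto_integral_of_dominated_convergence (fun x => ‖⟪u x, curl (curl u) x⟫‖)
      (fun n => (((contDiff_cutoff (n := 1) ((n : ℝ) + 1)).continuous).mul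
        (hu.continuous.inner cc)).aestronglyMeasurable)
      iuc.norm (fun n => Eventually.of_forall fun x => ?_) (Eventually.of_forall fun x => ?_)
    · rw [norm_mul, Real.norm_eq_abs]
      exact mul_le_of_le_one_left (norm_nonneg _) (abs_cutoff_le_one _ x)
    · have h := (tendsto_cutoff_natCast_add_one x).mul_const ⟪u x, curl (curl u) x⟫
      rwa [one_mul] at h
  -- `d n → 0`
  have hbd : ∀ n : ℕ, ‖d n‖ ≤ ‖curlCLM‖ * (C / ((n : ℝ) + 1)) * ∫ x, ‖u x‖ * ‖curl u x‖ := by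
    intro n
    have h := norm_integral_le_of_norm_le (iuω.const_mul (‖curlCLM‖ * (C / ((n : ℝ) + 1))))
      (Eventually.of_forall fun x => (?_ :
      ‖⟪u x, curlCLM ((fderiv ℝ (cutoff ((n : ℝ) + 1)) x).smulRight (curl u x))⟫‖ ≤
        ‖curlCLM‖ * (C / ((n : ℝ) + 1)) * (‖u x‖ * ‖curl u x‖)))
    · rw [integral_const_mul] at h
      exact h
    · refine (norm_inner_le_norm _ _).trans ?_
      have h1 := norm_curlCLM_smulRight_le (fderiv ℝ (cutoff ((n : ℝ) + 1)) x) (curl u x)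
      have h2 : ‖fderiv ℝ (cutoff ((n : ℝ) + 1)) x‖ ≤ C / ((n : ℝ) + 1) := hC _ (by positivity) x
      calc ‖u x‖ * ‖curlCLM ((fderiv ℝ (cutoff ((n : ℝ) + 1)) x).smulRight (curl u x))‖
          ≤ ‖u x‖ * (‖curlCLM‖ * (C / ((n : ℝ) + 1) * ‖curl u x‖)) := by
            refine mul_le_mul_of_nonneg_left (h1.trans ?_) (norm_nonneg _)
            exact mul_le_mul_of_nonneg_left (mul_le_mul_of_nonneg_right h2 (norm_nonneg _))
              (norm_nonneg curlCLM)
        _ = ‖curlCLM‖ * (C / ((n : ℝ) + 1)) * (‖u x‖ * ‖curl u x‖) := by ring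
  have hrate : Tendsto (fun n : ℕ => ‖curlCLM‖ * (C / ((n : ℝ) + 1)) * ∫ x, ‖u x‖ * ‖curl u x‖)
      atTop (𝓝 0) := by
    have h0 : Tendsto (fun n : ℕ => C / ((n : ℝ) + 1)) atTop (𝓝 0) := by
      have h := (tendsto_one_div_add_atTop_nhds_zero_nat (𝕜 := ℝ)).const_mul C
      rw [mul_zero] at h
      refine h.congr fun n => ?_
      rw [mul_one_div]
    have h := (h0.const_mul ‖curlCLM‖).mul_const (∫ x, ‖u x‖ * ‖curl u x‖)
    rwa [mul_zero, zero_mul] at h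
  have hd : Tendsto d atTop (𝓝 0) := squeeze_zero_norm hbd hrate
  have hsum : Tendsto (fun n => b n + d n) atTop (𝓝 (P + 0)) := hb.add hd
  rw [add_zero] at hsum
  exact (tendsto_nhds_unique (hsum.congr fun n => (hid n).symm) ha).symm ▸ rfl

/-- **`A ≥ Q`.** For `u ∈ C²` bounded with `u ∈ L²` and `|∇ curl u|_F ∈ L²`:
`(∫⟪u, curl ω⟫)² ≤ ‖u‖₂² · ∫ ⟪u, curl ω⟫²/‖u‖²` (Cauchy–Schwarz with `⟪u, c⟫ = ‖u‖·(⟪u, c⟫/‖u‖)`).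
With the alignment identity the left side is `‖ω‖₂⁴`, so the aligned palinstrophy fraction
`A = ∫(⟪u,curl ω⟫²/‖u‖²)/‖curl ω‖₂²` dominates the spectral concentration `Q = ‖ω‖₂⁴/(‖u‖₂²‖curl ω‖₂²)`
of `sq_integral_inner_convect_laplacian_le_mul_one_sub`. [folklore] -/
theorem sq_integral_inner_curl_curl_le (hu : ContDiff ℝ 2 u) (hM : ∀ x, ‖u x‖ ≤ M)
    (iE : Integrable (fun x => ‖u x‖ ^ 2))
    (iA : Integrable (fun x => frobeniusNormSq (fderiv ℝ (curl u) x))) :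
    (∫ x, ⟪u x, curl (curl u) x⟫) ^ 2 ≤
      (∫ x, ‖u x‖ ^ 2) * ∫ x, ⟪u x, curl (curl u) x⟫ ^ 2 / ‖u x‖ ^ 2 := by
  have cc : Continuous (curl (curl u)) := continuous_curl (contDiff_one_curl_of_contDiff_two hu)
  set g : EuclideanSpace ℝ (Fin 3) → ℝ := fun x => ⟪u x, curl (curl u) x⟫ / ‖u x‖ with hg
  have hpt : ∀ x, ⟪u x, curl (curl u) x⟫ = ‖u x‖ * g x := fun x => by
    rcases eq_or_ne (u x) 0 with h0 | h0
    · simp [h0]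
    · simp only [hg]
      rw [mul_div_cancel₀ _ (norm_ne_zero_iff.2 h0)]
  have hg2 : ∀ x, g x ^ 2 = ⟪u x, curl (curl u) x⟫ ^ 2 / ‖u x‖ ^ 2 := fun x => by
    simp only [hg, div_pow]
  have hgle : ∀ x, g x ^ 2 ≤ ‖curl (curl u) x‖ ^ 2 := fun x =>
    (hg2 x).symm ▸ (inner_cross_sq_le_direction (a := curl u x) (c := curl (curl u) x) (hM x)).1
  have meas_g : Measurable g :=
    (hu.continuous.inner cc).measurable.div hu.continuous.norm.measurable
  have mu : MemLp (fun x => ‖u x‖) 2 volume :=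
    (memLp_two_iff_integrable_sq hu.continuous.norm.aestronglyMeasurable).2 iE
  have ig2 : Integrable (fun x => g x ^ 2) :=
    (integrable_norm_curl_curl_sq hu iA).mono' (meas_g.pow_const 2).aestronglyMeasurable
      (Eventually.of_forall fun x => by
        rw [Real.norm_of_nonneg (sq_nonneg _)]; exact hgle x)
  have mg : MemLp (fun x => |g x|) 2 volume := by
    refine (memLp_two_iff_integrable_sq (meas_g.aestronglyMeasurable.norm)).2 ?_
    refine ig2.congr (Eventually.of_forall fun x => ?_)
    show g x ^ 2 = |g x| ^ 2
    rw [sq_abs]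
  have h1 : |∫ x, ⟪u x, curl (curl u) x⟫| ≤ ∫ x, ‖u x‖ * |g x| := by
    refine abs_integral_le_integral_abs.trans (le_of_eq (integral_congr_ae
      (Eventually.of_forall fun x => ?_)))
    show |⟪u x, curl (curl u) x⟫| = ‖u x‖ * |g x|
    rw [hpt x, abs_mul, abs_norm]
  have h2 : ∫ x, ‖u x‖ * |g x| ≤ Real.sqrt (∫ x, ‖u x‖ ^ 2) * Real.sqrt (∫ x, |g x| ^ 2) :=
    integral_mul_le_sqrt_mul_sqrt_of_memLp mu mg
  have h3 : ∫ x, |g x| ^ 2 = ∫ x, ⟪u x, curl (curl u) x⟫ ^ 2 / ‖u x‖ ^ 2 :=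
    integral_congr_ae (Eventually.of_forall fun x => by
      show |g x| ^ 2 = ⟪u x, curl (curl u) x⟫ ^ 2 / ‖u x‖ ^ 2
      rw [sq_abs, hg2 x])
  rw [h3] at h2
  have hE0 : 0 ≤ ∫ x, ‖u x‖ ^ 2 := integral_nonneg fun x => sq_nonneg _
  have hG0 : 0 ≤ ∫ x, ⟪u x, curl (curl u) x⟫ ^ 2 / ‖u x‖ ^ 2 :=
    integral_nonneg fun x => by positivity
  calc (∫ x, ⟪u x, curl (curl u) x⟫) ^ 2 = |∫ x, ⟪u x, curl (curl u) x⟫| ^ 2 := (sq_abs _).symm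
    _ ≤ (Real.sqrt (∫ x, ‖u x‖ ^ 2) *
          Real.sqrt (∫ x, ⟪u x, curl (curl u) x⟫ ^ 2 / ‖u x‖ ^ 2)) ^ 2 :=
        pow_le_pow_left₀ (abs_nonneg _) (h1.trans h2) 2
    _ = (∫ x, ‖u x‖ ^ 2) * ∫ x, ⟪u x, curl (curl u) x⟫ ^ 2 / ‖u x‖ ^ 2 := by
        rw [mul_pow, Real.sq_sqrt hE0, Real.sq_sqrt hG0]

/-- **`R² + Q ≤ 1` in S1's variables** (the landed spectral-concentration constraint
`sq_integral_inner_convect_laplacian_le_mul_one_sub`, re-derived from the direction-defect law with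
the lighter hypotheses of the definition's class plus finite energy): for `u ∈ C²` divergence-free,
bounded by `M`, with `u ∈ L²`, `ω = curl u ∈ L²`, `|∇ω|_F ∈ L²` and integrable stretching density,
`(∫⟪ω, Du ω⟫)² + M²‖ω‖₂² · (‖ω‖₂⁴/‖u‖₂²) ≤ M²‖ω‖₂²‖curl ω‖₂²` (`x/0 = 0`). [folklore] -/
theorem sq_integral_stretching_add_concentration_le (hu : ContDiff ℝ 2 u)
    (hdiv : VectorCalculus.IsDivFree u) (hM : ∀ x, ‖u x‖ ≤ M)
    (iE : Integrable (fun x => ‖u x‖ ^ 2))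
    (iZ : Integrable (fun x => ‖curl u x‖ ^ 2))
    (iA : Integrable (fun x => frobeniusNormSq (fderiv ℝ (curl u) x)))
    (iJ : Integrable (fun x => ⟪curl u x, fderiv ℝ u x (curl u x)⟫)) :
    (∫ x, ⟪curl u x, fderiv ℝ u x (curl u x)⟫) ^ 2 +
        M ^ 2 * (∫ x, ‖curl u x‖ ^ 2) * ((∫ x, ‖curl u x‖ ^ 2) ^ 2 / ∫ x, ‖u x‖ ^ 2) ≤
      M ^ 2 * (∫ x, ‖curl u x‖ ^ 2) * ∫ x, ‖curl (curl u) x‖ ^ 2 := by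
  have h := sq_integral_stretching_le_direction_defect hu hdiv hM iZ iA iJ
  have hCS := sq_integral_inner_curl_curl_le hu hM iE iA
  rw [integral_inner_curl_curl_eq hu iE iZ iA] at hCS
  have hMZ0 : 0 ≤ M ^ 2 * ∫ x, ‖curl u x‖ ^ 2 :=
    mul_nonneg (sq_nonneg _) (integral_nonneg fun x => sq_nonneg _)
  have hG0 : 0 ≤ ∫ x, ⟪u x, curl (curl u) x⟫ ^ 2 / ‖u x‖ ^ 2 :=
    integral_nonneg fun x => by positivity
  rcases eq_or_lt_of_le (integral_nonneg fun x => sq_nonneg ‖u x‖ :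
      (0 : ℝ) ≤ ∫ x, ‖u x‖ ^ 2) with hE0 | hEpos
  · rw [← hE0, div_zero, mul_zero, add_zero]
    nlinarith [mul_nonneg hMZ0 hG0]
  · have hQ : (∫ x, ‖curl u x‖ ^ 2) ^ 2 / ∫ x, ‖u x‖ ^ 2 ≤
        ∫ x, ⟪u x, curl (curl u) x⟫ ^ 2 / ‖u x‖ ^ 2 := by
      rw [div_le_iff₀ hEpos, mul_comm]
      exact hCS
    nlinarith [mul_le_mul_of_nonneg_left hQ hMZ0]

end Class

end Summit.NavierStokesRegularity.NavierStokesRegularity.Theorems.DepletionLadder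

end
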